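import Summits.HodgeConjecture.CorCM.Census.DecicWeil23PairTwoTransitive
import Summits.HodgeConjecture.CorCM.Census.DecicWeil23Triple
import HarnessLib

/-!
# THREE `(2,3)`-types over one DECIC CM field: the DEFECT LAW of all eight shapes from `2`-TRANSITIVITY alone — the averaged
# equation for any family of sign functions, and its solution shape by shape

COR-CM (cell `pub-hodgecm2`), seat b30 gen 23 (2026-08-22); count-neutral own lane DECIC-2T, part 2 (three types).  Bookkeeping
definitions and theorems of the finite model `Census/DecicWeil23Triple`; no named fact, no geometry, no `sorry`.

§1 THE AVERAGED EQUATION, GENERIC FORM (`fourMul_add_sum_eq_zero_of_twoTransitive'`).  For ANY finite index type `M` of slots,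
sign functions `s_m : Fin 5 → ℤ` with `Σ_y s_m(y) = σ_m`, a composition-closed `2`-TRANSITIVE set `R ⊆ Sym(5)` and unknowns
`e`, `d_{m,a}` satisfying `e + Σ_m Σ_a s_m(π a) d_{m,a} = 0` at every `π ∈ R`:
`4e + Σ_m Σ_a (a = b ? 4 s_m(x) : σ_m − s_m(x)) · d_{m,a} = 0` for all `b, x` — the fibre-averaging argument of
`Census/DecicWeil23PairTwoTransitive` (two slots, `σ = −1`), verbatim for `M` slots.
§2 THREE SLOTS.  With `s_m = ε_m` the signs of a shape `c < 8` (`sgnT`; `σ_m = −1`) the averaged equation reads, after summing out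
`a`, `w_b + Σ_{m ∋ x} t_{m,b} = 0` with `w_b = 4e − 4 Σ_m d_{m,b}` and `t_{m,b} = 10 d_{m,b} − 2 Σ_a d_{m,a}`; for each of the eight
shapes the five equations `x = 0, …, 4` force `w_b = t_{m,b} = 0` (`solveT`: the columns `𝟙, 𝟙_{I_0}, 𝟙_{I_1}, 𝟙_{I_2}` are
independent for three distinct `2`-subsets of five points), whence THE DEFECT LAW `d_{m,a} = d_{m,0}`,
`e = d_{0,0} + d_{1,0} + d_{2,0}` (`defectT_of_signed_twoTransitive`) — gen 22's `defectT_of_signed` (sixty `A₅` rows, integer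
certificates per shape) from `2`-transitivity, the Frobenius group `F₂₀` included.  Conversely the defect law gives the signed
equation at EVERY permutation (`signedT_of_defectT`).
§3 THE MODEL.  `phiPT c π` (the three types read through an arbitrary permutation `π`), `ModelBalancedPT c R v T`, the signed
form, and **`modelBalancedT_of_modelBalancedPT`**: balanced under a composition-closed `2`-transitive `R` ⟹ gen 22's
`ModelBalancedT` (all sixty `A₅`-equations) — so `Census/DecicWeil23Triple{Parts,Extraction}` and the CorCM triple files apply
BY NAME.
[cite: DixonMortimer1996, §2.1] [cite: MoonenZarhin1995Duke, Thm. 2.4] [cite: GaoUllmo2025, Thm 3.1] [cite: Pohlmann1968, Thm 1]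

## References
* [DixonMortimer1996] J. D. Dixon, B. Mortimer, *Permutation Groups*, GTM 163 (1996), §2.1.  [MoonenZarhin1995Duke] B. Moonen,
  Yu. Zarhin, Duke Math. J. 77 (1995), Thm. 2.4.  [GaoUllmo2025] Z. Gao, E. Ullmo, J. Inst. Math. Jussieu 25 (2025), Thm 3.1.
  [Pohlmann1968] H. Pohlmann, Ann. of Math. 88 (1968), Thm 1.

## Provenance
Exact python first (gen 22, `HOME/pub-hodgecm2-b30/decic-23pair/multi_types.py`, `triple.py`): three distinct `(2,3)`-types are
clean (nullity `3`) under `A₅`, `S₅` and all six conjugates of `F₂₀` (`720/720` ordered triples); this file replaces the tables by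
the averaging argument.
-/

namespace Summit.HodgeConjecture.CorCM.Census.DecicWeil23Triple

open Finset
open Summit.HodgeConjecture.CorCM.Census.DecicWeil23Pair (permD permD_facts card_filter₂_eq card_filter₂_diag
  card_filter_eq_sum_card_filter₂ sum_filter_apply_eq)

/-! ## §1 The averaged equation for any family of sign functions -/

section Generic

variable (R : Finset (Equiv.Perm (Fin 5))) {M : Type*} [Fintype M]

/-- **THE AVERAGED EQUATION (generic slots and signs).**  `R ⊆ Sym(5)` closed under composition and `2`-transitive; sign
functions `s_m` with `Σ_y s_m(y) = σ_m`; if `e + Σ_m Σ_a s_m(π a) d_{m,a} = 0` at every `π ∈ R` then for all `b, x`: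
`4e + Σ_m Σ_a (a = b ? 4 s_m(x) : σ_m − s_m(x)) · d_{m,a} = 0`. [cite: DixonMortimer1996, §2.1] [cite: MoonenZarhin1995Duke, Thm. 2.4] -/
theorem fourMul_add_sum_eq_zero_of_twoTransitive' (s : M → Fin 5 → ℤ) (σ : M → ℤ) (hs : ∀ m, ∑ y : Fin 5, s m y = σ m)
    (hmul : ∀ π₁ ∈ R, ∀ π₂ ∈ R, π₁ * π₂ ∈ R) (h2 : ∀ a b x y : Fin 5, a ≠ b → x ≠ y → ∃ π ∈ R, π a = x ∧ π b = y)
    (e : ℤ) (d : M → Fin 5 → ℤ) (h : ∀ π ∈ R, e + ∑ m, ∑ a : Fin 5, s m (π a) * d m a = 0) (b x : Fin 5) :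
    4 * e + ∑ m, ∑ a : Fin 5, (if a = b then 4 * s m x else σ m - s m x) * d m a = 0 := by
  obtain ⟨a₀, ha₀⟩ := exists_ne b
  obtain ⟨y₀, hy₀⟩ := exists_ne x
  set F : Finset (Equiv.Perm (Fin 5)) := R.filter fun π => π b = x with hF
  set n : ℕ := (R.filter fun π => π b = x ∧ π a₀ = y₀).card with hn
  have hfib : ∀ a, a ≠ b → ∀ y₁, y₁ ≠ x → F.card = 4 * (R.filter fun π => π b = x ∧ π a = y₁).card := by
    intro a ha y₁ hy₁
    rw [hF, card_filter_eq_sum_card_filter₂ R b a x, ← Finset.sum_erase_add _ _ (Finset.mem_univ x),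
      card_filter₂_diag R ha x, add_zero]
    have hc : ∀ y ∈ (univ : Finset (Fin 5)).erase x, (R.filter fun π => π b = x ∧ π a = y).card =
        (R.filter fun π => π b = x ∧ π a = y₁).card := fun y hy =>
      card_filter₂_eq R hmul h2 b a (Finset.ne_of_mem_erase hy).symm hy₁.symm
    rw [Finset.sum_congr rfl hc, Finset.sum_const, smul_eq_mul, Finset.card_erase_of_mem (Finset.mem_univ x),
      Finset.card_univ, Fintype.card_fin]
  have hN : F.card = 4 * n := hfib a₀ ha₀ y₀ hy₀
  have hn₂ : ∀ a, a ≠ b → ∀ y, y ≠ x → (R.filter fun π => π b = x ∧ π a = y).card = n := by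
    intro a ha y hy
    have h1 := hfib a ha y hy
    omega
  have hpos : 0 < n := by
    obtain ⟨π, hπ, hb, ha⟩ := h2 b a₀ x y₀ ha₀.symm hy₀.symm
    exact Finset.card_pos.2 ⟨π, Finset.mem_filter.2 ⟨hπ, hb, ha⟩⟩
  have hsum : ∑ π ∈ F, (e + ∑ m, ∑ a : Fin 5, s m (π a) * d m a) = 0 :=
    Finset.sum_eq_zero fun π hπ => h π (Finset.mem_filter.1 hπ).1
  have hswap : ∑ π ∈ F, ∑ m, ∑ a : Fin 5, s m (π a) * d m a = ∑ m, ∑ a : Fin 5, (∑ π ∈ F, s m (π a)) * d m a := by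
    rw [Finset.sum_comm]
    refine Finset.sum_congr rfl fun m _ => ?_
    rw [Finset.sum_comm]
    refine Finset.sum_congr rfl fun a _ => ?_
    rw [Finset.sum_mul]
  have hinner : ∀ m (a : Fin 5), ∑ π ∈ F, s m (π a) =
      if a = b then (4 * n : ℤ) * s m x else (n : ℤ) * (σ m - s m x) := by
    intro m a
    by_cases hab : a = b
    · rw [if_pos hab, hab, Finset.sum_congr rfl fun π hπ => by rw [(Finset.mem_filter.1 hπ).2], Finset.sum_const,
        nsmul_eq_mul, hN]
      push_cast
      ring
    · rw [if_neg hab, hF, sum_filter_apply_eq R b a x (s m), ← Finset.sum_erase_add _ _ (Finset.mem_univ x),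
        card_filter₂_diag R hab x, Nat.cast_zero, zero_mul, add_zero,
        Finset.sum_congr rfl fun y hy => by rw [hn₂ a hab y (Finset.ne_of_mem_erase hy)], ← Finset.mul_sum,
        Finset.sum_erase_eq_sub (Finset.mem_univ x), hs]
  rw [Finset.sum_add_distrib, Finset.sum_const, nsmul_eq_mul, hswap,
    Finset.sum_congr rfl fun m _ => Finset.sum_congr rfl fun a _ => by rw [hinner m a], hN] at hsum
  have hfactor : ((4 * n : ℕ) : ℤ) * e +
      ∑ m, ∑ a : Fin 5, (if a = b then (4 * n : ℤ) * s m x else (n : ℤ) * (σ m - s m x)) * d m a =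
      (n : ℤ) * (4 * e + ∑ m, ∑ a : Fin 5, (if a = b then 4 * s m x else σ m - s m x) * d m a) := by
    rw [mul_add, Finset.mul_sum]
    push_cast
    congr 1
    · ring
    · refine Finset.sum_congr rfl fun m _ => ?_
      rw [Finset.mul_sum]
      refine Finset.sum_congr rfl fun a _ => ?_
      split_ifs <;> ring
  rw [hfactor] at hsum
  exact (mul_eq_zero.1 hsum).resolve_left (by exact_mod_cast hpos.ne')

/-- `Σ_a (a = b ? α : β) · f a = (α − β) f b + β Σ_a f a`. [folklore] -/
theorem sum_ite_mul_eq (b : Fin 5) (α β : ℤ) (f : Fin 5 → ℤ) :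
    ∑ a : Fin 5, (if a = b then α else β) * f a = (α - β) * f b + β * ∑ a : Fin 5, f a := by
  rw [Finset.sum_congr rfl fun a _ => show (if a = b then α else β) * f a =
    (if a = b then (α - β) * f a else 0) + β * f a by split_ifs <;> ring, Finset.sum_add_distrib,
    Finset.sum_ite_eq' Finset.univ b, if_pos (Finset.mem_univ b), ← Finset.mul_sum]

end Generic

/-! ## §2 Three slots: signs of a shape, the linear solve, the defect law -/

/-- The sign `ε_m(y) = ±1` of the pair `y` for the type of slot `m` in shape `c`. [folklore] -/
def sgnT (c : Fin 8) (m : Fin 3) (y : Fin 5) : ℤ := if inPosT c m y then 1 else -1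

/-- `± t = ε_m(y) · t`. [folklore] -/
theorem ite_eq_sgnT_mul (c : Fin 8) (m : Fin 3) (y : Fin 5) (t : ℤ) :
    (if inPosT c m y then t else -t) = sgnT c m y * t := by
  unfold sgnT
  split_ifs <;> ring

/-- `Σ_y ε_m(y) = 2 − 3 = −1`. [folklore] -/
theorem sum_sgnT (c : Fin 8) (m : Fin 3) : ∑ y : Fin 5, sgnT c m y = -1 := by
  have h2 := card_inPosT c m
  have h5 : ((univ : Finset (Fin 5)).filter fun a => inPosT c m a = true).card +
      ((univ : Finset (Fin 5)).filter fun a => ¬ inPosT c m a = true).card = 5 := by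
    rw [Finset.card_filter_add_card_filter_not, Finset.card_univ, Fintype.card_fin]
  unfold sgnT
  rw [Finset.sum_ite, Finset.sum_const, Finset.sum_const, nsmul_eq_mul, nsmul_eq_mul]
  omega

/-- Summing out `a` in the averaged equation of slot `m`: `−4 f b + (x ∈ I_m ? 10 f b − 2 Σ_a f a : 0)`. [folklore] -/
theorem sum_probe_term (c : Fin 8) (m : Fin 3) (x b : Fin 5) (f : Fin 5 → ℤ) :
    ∑ a : Fin 5, (if a = b then 4 * sgnT c m x else -1 - sgnT c m x) * f a =
      -4 * f b + (if inPosT c m x then 10 * f b - 2 * ∑ a : Fin 5, f a else 0) := by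
  rw [sum_ite_mul_eq]
  unfold sgnT
  split_ifs <;> ring

/-- **The linear solve, shape by shape**: for each of the eight shapes the five equations `w + Σ_{m ∋ x} t_m = 0` (`x < 5`)
force `w = t_0 = t_1 = t_2 = 0` (the indicator columns of three distinct `2`-subsets of five points and the constant column are
independent). [folklore] -/
theorem solveT (c : Fin 8) (w t₀ t₁ t₂ : ℤ)
    (h : ∀ x : Fin 5, w + (if inPosT c 0 x then t₀ else 0) + (if inPosT c 1 x then t₁ else 0) +
      (if inPosT c 2 x then t₂ else 0) = 0) :
    w = 0 ∧ t₀ = 0 ∧ t₁ = 0 ∧ t₂ = 0 := by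
  have h0 := h 0; have h1 := h 1; have h2 := h 2; have h3 := h 3; have h4 := h 4
  fin_cases c <;> simp [inPosT, posT] at h0 h1 h2 h3 h4 <;> omega

variable (R : Finset (Equiv.Perm (Fin 5)))

/-- **THE DEFECT LAW FROM `2`-TRANSITIVITY (three types, all eight shapes).**  For `R ⊆ Sym(5)` closed under composition and
`2`-transitive, the signed equations `e + Σ_{m,a} ± d_{m,a} = 0` (sign `+` iff `π a ∈ posT c m`) at all `π ∈ R` force
`d_{m,a} = d_{m,0}` for all `m, a` AND `e = d_{0,0} + d_{1,0} + d_{2,0}`. [cite: MoonenZarhin1995Duke, Thm. 2.4]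
[cite: GaoUllmo2025, Thm 3.1] [cite: DixonMortimer1996, §2.1] -/
theorem defectT_of_signed_twoTransitive (c : Fin 8) (hmul : ∀ π₁ ∈ R, ∀ π₂ ∈ R, π₁ * π₂ ∈ R)
    (h2 : ∀ a b x y : Fin 5, a ≠ b → x ≠ y → ∃ π ∈ R, π a = x ∧ π b = y) (e : ℤ) (d : Fin 3 → Fin 5 → ℤ)
    (h : ∀ π ∈ R, e + ∑ m : Fin 3, ∑ a : Fin 5, (if inPosT c m (π a) then d m a else -d m a) = 0) :
    (∀ (m : Fin 3) (a : Fin 5), d m a = d m 0) ∧ e = d 0 0 + d 1 0 + d 2 0 := by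
  have h' : ∀ π ∈ R, e + ∑ m : Fin 3, ∑ a : Fin 5, sgnT c m (π a) * d m a = 0 := by
    intro π hπ
    rw [← h π hπ]
    simp only [ite_eq_sgnT_mul]
  have key := fourMul_add_sum_eq_zero_of_twoTransitive' R (sgnT c) (fun _ => -1) (sum_sgnT c) hmul h2 e d h'
  -- the probe equations in the form `w_b + Σ_{m ∋ x} t_{m,b} = 0`
  have hx : ∀ b x : Fin 5, (4 * e - 4 * (d 0 b + d 1 b + d 2 b)) +
      (if inPosT c 0 x then 10 * d 0 b - 2 * ∑ a : Fin 5, d 0 a else 0) +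
      (if inPosT c 1 x then 10 * d 1 b - 2 * ∑ a : Fin 5, d 1 a else 0) +
      (if inPosT c 2 x then 10 * d 2 b - 2 * ∑ a : Fin 5, d 2 a else 0) = 0 := by
    intro b x
    have hb := key b x
    simp only [sum_probe_term, Fin.sum_univ_three] at hb
    linarith
  have ht : ∀ b : Fin 5, 4 * e - 4 * (d 0 b + d 1 b + d 2 b) = 0 ∧ 10 * d 0 b - 2 * ∑ a : Fin 5, d 0 a = 0 ∧
      10 * d 1 b - 2 * ∑ a : Fin 5, d 1 a = 0 ∧ 10 * d 2 b - 2 * ∑ a : Fin 5, d 2 a = 0 := fun b =>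
    solveT c _ _ _ _ (hx b)
  have hd : ∀ (m : Fin 3) (b : Fin 5), 5 * d m b = ∑ a : Fin 5, d m a := by
    intro m b
    obtain ⟨-, h₀, h₁, h₂⟩ := ht b
    fin_cases m
    · change 5 * d 0 b = ∑ a : Fin 5, d 0 a; linarith
    · change 5 * d 1 b = ∑ a : Fin 5, d 1 a; linarith
    · change 5 * d 2 b = ∑ a : Fin 5, d 2 a; linarith
  refine ⟨fun m a => ?_, by have h₁ := (ht 0).1; linarith⟩
  have h₁ := hd m a; have h₂ := hd m 0
  linarith

/-- **Conversely, the defect law gives the signed equation at EVERY permutation of the pairs.** [folklore] -/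
theorem signedT_of_defectT (c : Fin 8) (π : Equiv.Perm (Fin 5)) {e : ℤ} {d : Fin 3 → Fin 5 → ℤ}
    (hd : ∀ (m : Fin 3) (a : Fin 5), d m a = d m 0) (he : e = d 0 0 + d 1 0 + d 2 0) :
    e + ∑ m : Fin 3, ∑ a : Fin 5, (if inPosT c m (π a) then d m a else -d m a) = 0 := by
  have key : ∀ m : Fin 3, ∑ a : Fin 5, (if inPosT c m (π a) then d m a else -d m a) = -d m 0 := by
    intro m
    rw [Finset.sum_congr rfl fun a _ => by rw [hd m a, ite_eq_sgnT_mul], ← Finset.sum_mul,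
      Equiv.sum_comp π (sgnT c m), sum_sgnT]
    ring
  rw [Fin.sum_univ_three, key, key, key, he]
  ring

/-! ## §3 The three types read through an arbitrary permutation; `R`-balanced ⟹ `A₅`-balanced -/

/-- `π⁻¹(type)` read in the three-slot model for an ARBITRARY permutation `π` (Boolean form). [cite: GaoUllmo2025, Thm 3.1 (3.2)] -/
def inPhiPT (c : Fin 8) (π : Fin 5 → Fin 5) : PtT → Bool
  | Sum.inl b => b
  | Sum.inr (m, (a, b)) => b == inPosT c m (π a)

/-- `π⁻¹(type)` as a finset of the three-slot model. [cite: GaoUllmo2025, Thm 3.1 (3.2)] -/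
def phiPT (c : Fin 8) (π : Fin 5 → Fin 5) : Finset PtT := univ.filter fun y => inPhiPT c π y = true

/-- Membership, curve slot. [folklore] -/
theorem inl_mem_phiPT (c : Fin 8) (π : Fin 5 → Fin 5) (b : Bool) : Sum.inl b ∈ phiPT c π ↔ b = true := by
  simp [phiPT, inPhiPT]

/-- Membership, fivefold slots. [folklore] -/
theorem inr_mem_phiPT (c : Fin 8) (π : Fin 5 → Fin 5) (m : Fin 3) (a : Fin 5) (b : Bool) :
    Sum.inr (m, (a, b)) ∈ phiPT c π ↔ b = inPosT c m (π a) := by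
  simp [phiPT, inPhiPT]

/-- `phiPT c π` as an explicit finset. [folklore] -/
theorem phiPT_eq (c : Fin 8) (π : Fin 5 → Fin 5) : phiPT c π =
    insert (Sum.inl true) ((univ : Finset (Fin 3 × Fin 5)).image fun q => (Sum.inr (q.1, (q.2, inPosT c q.1 (π q.2))) : PtT)) := by
  ext y
  rw [Finset.mem_insert, Finset.mem_image]
  rcases y with b | ⟨m, a, b⟩
  · rw [inl_mem_phiPT]
    constructor
    · rintro rfl
      exact Or.inl rfl
    · rintro (h | ⟨q, -, hq⟩)
      · exact Sum.inl_injective h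
      · exact absurd hq Sum.inr_ne_inl
  · rw [inr_mem_phiPT]
    constructor
    · rintro rfl
      exact Or.inr ⟨(m, a), Finset.mem_univ _, rfl⟩
    · rintro (h | ⟨⟨m', a'⟩, -, hq⟩)
      · exact absurd h Sum.inr_ne_inl
      · simp only [Sum.inr.injEq, Prod.mk.injEq] at hq
        obtain ⟨rfl, rfl, rfl⟩ := hq
        rfl

/-- The sum over `phiPT c π`, expanded. [folklore] -/
theorem sum_phiPT (c : Fin 8) (π : Fin 5 → Fin 5) (N : PtT → ℕ) :
    ∑ y ∈ phiPT c π, N y = N (Sum.inl true) + ∑ m : Fin 3, ∑ a : Fin 5, N (Sum.inr (m, (a, inPosT c m (π a)))) := by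
  rw [phiPT_eq c π]
  have hinj : Function.Injective fun q : Fin 3 × Fin 5 => (Sum.inr (q.1, (q.2, inPosT c q.1 (π q.2))) : PtT) := by
    rintro ⟨m, a⟩ ⟨m', a'⟩ h
    simp only [Sum.inr.injEq, Prod.mk.injEq] at h
    obtain ⟨rfl, rfl, -⟩ := h
    rfl
  have h1 : Sum.inl true ∉ (univ : Finset (Fin 3 × Fin 5)).image
      fun q => (Sum.inr (q.1, (q.2, inPosT c q.1 (π q.2))) : PtT) := by simp
  rw [Finset.sum_insert h1, Finset.sum_image fun q _ q' _ h => hinj h, Fintype.sum_prod_type]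

/-- **The signed form of the balance equation at `π`** (three slots). [cite: GaoUllmo2025, Thm 3.1] -/
theorem balancedPT_iff_signed (c : Fin 8) (π : Fin 5 → Fin 5) (N : PtT → ℕ) :
    2 * ∑ y ∈ phiPT c π, N y = ∑ y : PtT, N y ↔
      ((N (Sum.inl true) : ℤ) - N (Sum.inl false)) + ∑ m : Fin 3, ∑ a : Fin 5,
        (if inPosT c m (π a) then ((N (Sum.inr (m, (a, true))) : ℤ) - N (Sum.inr (m, (a, false))))
          else -(((N (Sum.inr (m, (a, true))) : ℤ) - N (Sum.inr (m, (a, false)))))) = 0 := by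
  rw [sum_phiPT, sum_ptT]
  have key : ∀ m a, (2 * (N (Sum.inr (m, (a, inPosT c m (π a)))) : ℤ)) =
      ((N (Sum.inr (m, (a, true))) : ℤ) + N (Sum.inr (m, (a, false)))) +
        (if inPosT c m (π a) then ((N (Sum.inr (m, (a, true))) : ℤ) - N (Sum.inr (m, (a, false))))
          else -(((N (Sum.inr (m, (a, true))) : ℤ) - N (Sum.inr (m, (a, false)))))) := by
    intro m a
    cases inPosT c m (π a) <;> simp <;> ring
  have hsum : (2 * (∑ m : Fin 3, ∑ a : Fin 5, N (Sum.inr (m, (a, inPosT c m (π a))))) : ℤ) =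
      (∑ m : Fin 3, ∑ a : Fin 5, (((N (Sum.inr (m, (a, true))) : ℤ) + N (Sum.inr (m, (a, false)))))) +
        ∑ m : Fin 3, ∑ a : Fin 5,
          (if inPosT c m (π a) then ((N (Sum.inr (m, (a, true))) : ℤ) - N (Sum.inr (m, (a, false))))
            else -(((N (Sum.inr (m, (a, true))) : ℤ) - N (Sum.inr (m, (a, false)))))) := by
    push_cast
    rw [Finset.mul_sum, ← Finset.sum_add_distrib]
    refine Finset.sum_congr rfl fun m _ => ?_
    rw [Finset.mul_sum, ← Finset.sum_add_distrib]
    refine Finset.sum_congr rfl fun a _ => ?_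
    exact key m a
  constructor
  · intro h
    have hz : (2 : ℤ) * ((N (Sum.inl true) : ℤ) + ((∑ m : Fin 3, ∑ a : Fin 5, N (Sum.inr (m, (a, inPosT c m (π a)))) : ℕ) : ℤ)) =
        (N (Sum.inl true) : ℤ) + N (Sum.inl false) +
          ((∑ m : Fin 3, ∑ a : Fin 5, (N (Sum.inr (m, (a, true))) + N (Sum.inr (m, (a, false)))) : ℕ) : ℤ) := by
      exact_mod_cast h
    push_cast at hz hsum
    linarith
  · intro h
    have hz : (2 : ℤ) * ((N (Sum.inl true) : ℤ) + ((∑ m : Fin 3, ∑ a : Fin 5, N (Sum.inr (m, (a, inPosT c m (π a)))) : ℕ) : ℤ)) =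
        (N (Sum.inl true) : ℤ) + N (Sum.inl false) +
          ((∑ m : Fin 3, ∑ a : Fin 5, (N (Sum.inr (m, (a, true))) + N (Sum.inr (m, (a, false)))) : ℕ) : ℤ) := by
      push_cast at hsum ⊢
      linarith
    exact_mod_cast hz

variable {α : Type*}

/-- **Balanced configurations (three slots) under a set `R` of realised permutations.** [cite: GaoUllmo2025, Thm 3.1 eq. (3.2)]
[cite: Pohlmann1968, Thm 1] -/
def ModelBalancedPT (c : Fin 8) (R : Finset (Equiv.Perm (Fin 5))) (v : α → PtT) (T : Finset α) : Prop :=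
  ∀ π ∈ R, 2 * (T.filter fun x => v x ∈ phiPT c π).card = T.card

variable {R} {c : Fin 8} {v : α → PtT}

/-- **The defect law of fibre counts balanced under `R`** (three slots). [cite: MoonenZarhin1995Duke, Thm. 2.4] [cite: GaoUllmo2025, Thm 3.1] -/
theorem defect_of_balancedPT (hmul : ∀ π₁ ∈ R, ∀ π₂ ∈ R, π₁ * π₂ ∈ R)
    (h2 : ∀ a b x y : Fin 5, a ≠ b → x ≠ y → ∃ π ∈ R, π a = x ∧ π b = y) (N : PtT → ℕ)
    (hN : ∀ π ∈ R, 2 * ∑ y ∈ phiPT c π, N y = ∑ y : PtT, N y) :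
    (∀ (m : Fin 3) (a : Fin 5), (N (Sum.inr (m, (a, true))) : ℤ) - N (Sum.inr (m, (a, false))) =
        (N (Sum.inr (m, (0, true))) : ℤ) - N (Sum.inr (m, (0, false)))) ∧
      (N (Sum.inl true) : ℤ) - N (Sum.inl false) = (N (Sum.inr (0, (0, true))) : ℤ) - N (Sum.inr (0, (0, false))) +
        ((N (Sum.inr (1, (0, true))) : ℤ) - N (Sum.inr (1, (0, false)))) +
        ((N (Sum.inr (2, (0, true))) : ℤ) - N (Sum.inr (2, (0, false)))) :=
  defectT_of_signed_twoTransitive R c hmul h2 _ (fun m a => (N (Sum.inr (m, (a, true))) : ℤ) - N (Sum.inr (m, (a, false))))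
    fun π hπ => (balancedPT_iff_signed c π N).1 (hN π hπ)

/-- **`R`-BALANCED ⟹ `A₅`-BALANCED (three slots).**  If `R` is closed under composition and `2`-transitive, a configuration
balanced under `R` satisfies all sixty equations `ModelBalancedT` of `Census/DecicWeil23Triple`. [cite: MoonenZarhin1995Duke, Thm. 2.4]
[cite: GaoUllmo2025, Thm 3.1] -/
theorem modelBalancedT_of_modelBalancedPT (hmul : ∀ π₁ ∈ R, ∀ π₂ ∈ R, π₁ * π₂ ∈ R)
    (h2 : ∀ a b x y : Fin 5, a ≠ b → x ≠ y → ∃ π ∈ R, π a = x ∧ π b = y) {T : Finset α}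
    (hT : ModelBalancedPT c R v T) : ModelBalancedT c v T := by
  obtain ⟨hd, he⟩ := defect_of_balancedPT hmul h2 (fun y => (T.filter fun x => v x = y).card) fun π hπ => by
    rw [← card_filter_mem_eq_sumT, ← card_eq_sumT v T]; exact hT π hπ
  intro r
  rw [card_filter_mem_eq_sumT, card_eq_sumT v T, balancedT_iff_signed]
  exact signedT_of_defectT c (Equiv.ofBijective (permD r) (Finite.injective_iff_bijective.1 (permD_facts.1 r))) hd he

/-- **… and is then balanced at EVERY permutation of the pairs.** [folklore] -/
theorem balancedPT_of_modelBalancedPT (hmul : ∀ π₁ ∈ R, ∀ π₂ ∈ R, π₁ * π₂ ∈ R)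
    (h2 : ∀ a b x y : Fin 5, a ≠ b → x ≠ y → ∃ π ∈ R, π a = x ∧ π b = y) {T : Finset α}
    (hT : ModelBalancedPT c R v T) (π : Equiv.Perm (Fin 5)) : 2 * (T.filter fun x => v x ∈ phiPT c π).card = T.card := by
  obtain ⟨hd, he⟩ := defect_of_balancedPT hmul h2 (fun y => (T.filter fun x => v x = y).card) fun π hπ => by
    rw [← card_filter_mem_eq_sumT, ← card_eq_sumT v T]; exact hT π hπ
  rw [card_filter_mem_eq_sumT, card_eq_sumT v T, balancedPT_iff_signed]
  exact signedT_of_defectT c π hd he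

end Summit.HodgeConjecture.CorCM.Census.DecicWeil23Triple
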